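/-
Copyright: statement-level skeleton of a published paper (lit-balaban cell, Phase-2 proof seat p25, gen 18). No proof
claims beyond what the kernel checks below.
-/
import Literature.MathematicalPhysics.QuantumFieldTheory.BalabanImbrieJaffe1984to88.BIJ88WalkBlockNorm312

/-!
# `BalabanImbrieJaffe1984to88.BIJ88WalkBlockSupport312` — T. Bałaban, J. Imbrie, A. Jaffe, *Effective action and cluster
properties of the abelian Higgs model*, Commun. Math. Phys. **114** (1988) 257–315 [BalabanImbrieJaffe1988], §5.14
p. 311–312 [PDF 55–56], verbatim: *"Let X denote the union of the cubes covering the X_{σ_i} and the regions from the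
random walk expansion. A connected component of X is called complete if …"*, *"Summing all possible diagrams in X_c
gives the constant observable F^L_{k+1,loc}(X_c)"* — **THE CONSTANT-COMPONENT ACTIVITIES LIVE ON `R`-CONNECTED CUBE
SETS, AND THEIR NORM PER BLOCK OF OBSERVABLES** (p25 gen 18): (i) under the linking hypotheses of
`BIJ88WalkGeometry311.run_conn` (a non-zero bracket `⟨C_p u, w⟩` links the cubes of `u`, `w` and the region of `p`;
observables and vertices are localized in connected cube sets) the activity `flAt i B X` VANISHES unless `X` is
`R`-connected (`flAt_eq_zero_of_not_isRConnected`) — the activities of the block gas are supported on polymers;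
(ii) for a block `Q` of observables (least observable `i`, environment `Q ∖ i`) the Kotecký–Preiss-type norm of
`BIJ88WalkBlockNorm312` reads `Σ_{X} flAbsAt(min Q, Q∖min Q, X)·(√θ)^{−#(X ∖ ⋃_{j∈Q} oc j)} ≤ W^{Φ(Q)}·Π_{j∈Q} B_ℓ^{|obs j|}`,
`Φ(Q) = Σ_{j∈Q}|obs j| + 1 + M·maxArity` (`block_norm_le`).

statement-level skeleton of published theorems with citation tags; proofs where landed; nothing here is a claim
about the Yang–Mills mass gap

PDF held: `paper:balaban1988-cmp114-bij-abelian-higgs-effective-action` (journal page = PDF page + 256); p. 311–312 =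
PDF 55–56 (`p0055.txt` L23–38, `p0056.txt` L1–25 re-read this session, 2026-08-22).

CITATION HEADER (lean-in-tree rule).  lit-balaban cell (HOME `run/shared/lean/pub/lit-balaban/`), Phase 2, seat p25
gen 18; row **C2.Claim@312** of `HOME/lit-balaban-r16/ROWS-C2-part2.md` (owner r16, referee ref-5; head
`BIJ88Sect5StatementsPart4.Ineq312` untouched — MEMBER of the row).  USED BY NAME, nothing restated:
`BIJ88WalkBlockActivity312.{flAt, flAbsAt}`, `BIJ88WalkBlockNorm312.sum_flAbsAt_weighted_le`,
`BIJ88WalkGeometry311.{Geo, run_conn_pristine, Nondeg}`, `BIJ88WalkRunEnv311.run_const`, `BIJ88WalkRun311`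
(this seat and generation), `LatticeModels.IsRConnected`, `BIJ88VertexComponents311.maxArity`.

## What is proved (0 `sorry`, standard axioms, no new `Prop` facts; theorems only)

* §1 **`flAt_eq_zero_of_not_isRConnected`**.
* §2 **`block_norm_le`**.
HONEST SCOPE: (a) constant components only; (b) the linking hypotheses (`hlink`, `hhalf`) and the locality/convergence
hypotheses are abstract; (c) contraction-graph components; (d) no `Ineq312` binder.  NOT summit progress; NOT
continuum; NOT Clay.  Imports `BIJ88WalkBlockNorm312`; modifies nothing.
-/

noncomputable section

namespace Literature.MathematicalPhysics.QuantumFieldTheory.BalabanImbrieJaffe1984to88.BIJ88WalkBlockSupport312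

open Classical Matrix Finset
open scoped BigOperators
open Literature.Probability.LatticeModels (IsRConnected)
open BIJ88VertexComponents311 (maxArity)
open BIJ88WalkRun311 BIJ88WalkRunEnv311 BIJ88WalkGeometry311 BIJ88WalkBlockActivity312 BIJ88WalkBlockNorm312

variable {S : Type} [Fintype S] {ι : Type} [Fintype ι] {κ : Type} [LinearOrder κ] {P : Type} [Fintype P]
  {β : Type} [DecidableEq β]

variable {Cov : P → Matrix S S ℝ} {trig : P → Bool} {f : S → ℝ} {c : ι → ℝ} {legs : ι → List (S → ℝ)}
  {obs : κ → List (S → ℝ)} {M : ℕ} {oc : κ → Finset β} {vc : ι → Finset β} {reg : P → Finset β}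

/-! ## §1  The activities live on `R`-connected cube sets -/

/-- **THE CONSTANT-COMPONENT ACTIVITY VANISHES OFF THE `R`-CONNECTED CUBE SETS**: if a non-zero bracket `⟨C_p u, w⟩`
makes `{lc u, lc w} ∪ reg p` `R`-connected (and `C_p u ≠ 0` makes `{lc u} ∪ reg p` so), every observable's legs lie
in its `R`-connected cube set `oc j` and every vertex's legs in its `R`-connected `vc m`, then `flAt i B X = 0`
unless `X` is `R`-connected — a constant outcome with a non-zero weight is nondegenerate, and nondegenerate runs keep
their cubes connected (`run_conn`). [cite: BalabanImbrieJaffe1988, §5.14 p.311–312] -/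
theorem flAt_eq_zero_of_not_isRConnected {R : β → β → Prop} {lc : (S → ℝ) → β}
    (hlink : ∀ p u w, (Cov p *ᵥ u) ⬝ᵥ w ≠ 0 → IsRConnected R (insert (lc u) (insert (lc w) (reg p))))
    (hhalf : ∀ p u, Cov p *ᵥ u ≠ 0 → IsRConnected R (insert (lc u) (reg p)))
    (hocc : ∀ j, IsRConnected R (oc j)) (hobs : ∀ j, ∀ w ∈ obs j, lc w ∈ oc j)
    (hvcc : ∀ m, IsRConnected R (vc m)) (hlegs : ∀ m, ∀ w ∈ legs m, lc w ∈ vc m)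
    (i : κ) (B : Finset κ) {X : Finset β} (hX : ¬ IsRConnected R X) :
    flAt Cov trig f c legs obs M oc vc reg i B X = 0 := by
  refine Multiset.sum_eq_zero fun x hx => ?_
  obtain ⟨o, ho, rfl⟩ := Multiset.mem_map.1 hx
  by_cases hcl : o.g.IsConst M ∧ o.rest = ∅ ∧ cubes oc vc reg o.g = X
  swap
  · exact if_neg hcl
  rw [if_pos hcl]
  by_contra ha
  obtain ⟨hD, -, -⟩ := run_const _ _ _ o ho (fun h hh => absurd hh (Multiset.notMem_zero _)) hcl.1
  have hnd : Nondeg o := ⟨ha, fun z hz => by rw [hD] at hz; exact absurd hz List.not_mem_nil⟩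
  have hgeo := (run_conn_pristine (trig := trig) (f := f) (c := c) (M := M) hlink hhalf hocc hobs hvcc hlegs i B
    (done := 0) (fun h hh => absurd hh (Multiset.notMem_zero _)) o ho hnd).1
  exact hX (hcl.2.2 ▸ hgeo.1)

/-! ## §2  The norm per block of observables -/

/-- **THE NORM OF THE CONSTANT COMPONENT OF A BLOCK `Q`**: under the hypotheses of
`BIJ88WalkBlockNorm312.sum_flAbsAt_weighted_le` with `Φ(Q) = Σ_{j∈Q}|obs j| + 1 + M·maxArity` and
`ρ₀·(Φ(Q) + N₀) ≤ W`, for a non-empty block `Q` (run from its least observable `i`, environment `Q ∖ i`) and every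
finite family `𝒳` of cube sets:
`Σ_{X∈𝒳} flAbsAt i (Q∖i) X · ((√θ)^{#(X ∖ ⋃_{j∈Q} oc j)})⁻¹ ≤ W^{Φ(Q)} · Π_{j∈Q} B_ℓ^{|obs j|}`.
[cite: BalabanImbrieJaffe1988, §5.14 p.312] -/
theorem block_norm_le {Dir : Set (S → ℝ)} {B' ρ : P → ℝ} {cV : ι → ℝ} {Bl θ ρ₀ W : ℝ} {N₀ : ℕ}
    (hθ0 : 0 < θ) (hθ1 : θ ≤ 1) (hBl : 1 ≤ Bl) (hB0 : ∀ p, 0 ≤ B' p) (hρ : ∀ p, 0 ≤ ρ p) (hcV0 : ∀ m, 0 ≤ cV m)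
    (hB : ∀ p, ∀ u ∈ Dir, ∀ w ∈ Dir, |(Cov p *ᵥ u) ⬝ᵥ w| ≤ B' p * ρ p)
    (hBf : ∀ p, ∀ u ∈ Dir, |(Cov p *ᵥ u) ⬝ᵥ f| ≤ B' p * ρ p) (hBz : ∀ p, ∀ u ∈ Dir, ‖Cov p *ᵥ u‖ ≤ B' p * ρ p)
    (hcV : ∀ m, |c m| ≤ cV m) (hobs : ∀ j, ∀ w ∈ obs j, w ∈ Dir) (hlegs : ∀ m, ∀ w ∈ legs m, w ∈ Dir)
    (hloc : ∀ p, trig p = false → B' p ≤ Bl ∧ reg p = ∅) (hwalk : ∀ p, trig p = true → B' p ≤ θ ^ (reg p).card)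
    (hvert : ∀ m, cV m * Bl ^ (legs m).length ≤ θ ^ (vc m).card)
    (hρ₀ : ∀ u ∈ Dir, (∑ p ∈ univ.filter (fun p => Cov p *ᵥ u ≠ 0), ρ p) ≤ ρ₀)
    (hN : ∀ p, ∀ u ∈ Dir,
      (∑ m, ((range (legs m).length).filter fun j => (Cov p *ᵥ u) ⬝ᵥ (legs m).getD j 0 ≠ 0).card) ≤ N₀)
    {Q : Finset κ} (hQ : Q.Nonempty) (hW1 : 1 ≤ W)
    (hW : ρ₀ * ((∑ j ∈ Q, (obs j).length + 1 + M * maxArity legs + N₀ : ℕ) : ℝ) ≤ W) (𝒳 : Finset (Finset β)) :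
    ∑ X ∈ 𝒳, flAbsAt Cov trig f c legs obs M oc vc reg (Q.min' hQ) (Q.erase (Q.min' hQ)) X
          * (Real.sqrt θ ^ (X \ Q.biUnion oc).card)⁻¹
      ≤ W ^ (∑ j ∈ Q, (obs j).length + 1 + M * maxArity legs) * ∏ j ∈ Q, Bl ^ (obs j).length := by
  have hi := Q.min'_mem hQ
  have e : (obs (Q.min' hQ)).length + 1 + M * maxArity legs + ∑ j ∈ Q.erase (Q.min' hQ), (obs j).length
      = ∑ j ∈ Q, (obs j).length + 1 + M * maxArity legs := by
    rw [← Finset.add_sum_erase Q (fun j => (obs j).length) hi]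
    ring
  have h := sum_flAbsAt_weighted_le (trig := trig) (c := c) (oc := oc) hθ0 hθ1 hBl hB0 hρ hcV0 hB hBf hBz hcV hobs
    hlegs hloc hwalk hvert hρ₀ hN (i := Q.min' hQ) (B := Q.erase (Q.min' hQ)) (Finset.notMem_erase _ _) hW1
    (by rw [e]; exact hW) 𝒳
  rw [e, Finset.insert_erase hi] at h
  exact h

end Literature.MathematicalPhysics.QuantumFieldTheory.BalabanImbrieJaffe1984to88.BIJ88WalkBlockSupport312

end
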